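import Mathlib.Order.Filter.AtTopBot.Basic
import Literature.AnabelianGeometry.SemiGraphs.ThetaRayGraph
import Literature.AnabelianGeometry.SemiGraphs.CharacteristicOpenCore
import Literature.AnabelianGeometry.SemiGraphs.TwistUniformConvergence
import Literature.AnabelianGeometry.SemiGraphs.FreeProPRankTwo
import Literature.AnabelianGeometry.SemiGraphs.FreeProPRankTwoGluing
import HarnessLib

/-!
# The escape schedule `n_k` of `𝒢_θ` and the coincidence binder (hcoin) ([SemiAnbd] Thm 3.7 (iii), p. 41)

Mochizuki, *Semi-graphs of anabelioids*, Publ. RIMS **42** (2006) [MochizukiSemiAnbd2006], proof of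
Theorem 3.7 (iii), author's manuscript p. 41 ("this action factors through a finite quotient … a compatible
system of vertices of `𝒢_{∞,j}` fixed by `H`"); the printed proof covers FINITE `𝔾` (kernel:
`compactInVerticialAt_of_finiteGraph`, p431007). [cite: MochizukiSemiAnbd2006, Thm 3.7(iii) p.41]

PROOF-ONLY file (abc-iut cell, layer L3, FRONTIER programme REFUTE-F1732
`plan/L3/SUBDAG-SemiAnbd-Thm37iii-REFUTE.md`, row «R6-SCHEDULE» (α90); seat abc-iut-L3-t7 gen 6; 0 definitions,
0 named facts).  Honest framing (α59): towards a kernel erratum for the ∀-countable reading of Thm 3.7 (iii) as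
amended by [IUTchI] Rmk 2.5.3; desk countermodel `𝒢_θ` of abc-iut-L3-d1 g3 (memo
HOME/staging/L3/L3-d1/g3/COUNTERMODEL-Thm37iii-infinite.md, sha16 8b26b5199c29f55f).  Nothing here bears on
[IUTchIII] Cor. 3.12 (IUT uses finite dual semi-graphs only); typed ≠ proved; no refutation is claimed here.

WHAT THE SCHEDULE MUST DO.  In `𝒢_θ = thetaRayOfTwists G E α θ n` (`ThetaRayGraph.lean`: gluing `α` at
`β_k⁺`, `θ_{n_k} ∘ α` at `β_k⁻`) the exponent sequence `n : ℕ → ℕ` enters the escape (abc-iut-L3-d4's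
`thetaRay_not_compactInVerticialAt_of_levelEscape`, `ThetaRayEscape.lean`) at exactly two places:

1. the LEVEL COINCIDENCE (hz) of the apartment generators `z_k`, which abc-iut-L3-t11's
   `ThetaRayEscapeLevelData.lean` reduces to the purely group-theoretic binder
   (hcoin) `∀ d, ∃ N, ∀ k ≥ N, (low (k+1) e₀)⁻¹ · up e₀ ∈ charOpenCore G d`
   — the level-`m` modulus being the CONSTANT fibre cardinality `#(S_m)_{v_0}` along the ray
   (`thetaRay_card_SV_eq`), so NO diagonal / recursive schedule is needed: since
   `(θ_m a)⁻¹ · a = b^{-p^m}` and every characteristic open core of a topologically finitely generated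
   pro-`p` group swallows `b^{p^m}` for `m ≫ 0` (brick R1b, `TwistUniformConvergence.lean`), (hcoin) holds for
   EVERY schedule with `n_k → ∞` (`hcoin_comp_of_tendsto`, `FreeProPRankTwo.hcoin_of_twists`);
2. the separation (hsep) inside (hcrit) at a FIXED position `k` at level `p^e`, which needs only `n_k < e`
   (abc-iut-w6-d096's `hsep_of_abelianisation_zmod`) — a condition on the DEPTH `e` of the level, met at
   deep levels for any `n` (`exists_forall_lt_level`); the cumulative-twist variant wants `StrictMono n`.

Hence the schedule of record is `n := Nat.succ` (strictly increasing, `n_0 = 1`, the memo's "strictly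
increasing, `n_0 ≥ 1`"), and every statement below is in BINDER form `(hn : Tendsto n atTop atTop)`
(implied by `StrictMono n`).  Consumers: abc-iut-L3-t10's REFUTE JUNCTION («missing» items (2) schedule and
(4)-hz), abc-iut-L3-t11's `thetaRay_not_compactInVerticial_of_hcrit` (hcoin := `FreeProPRankTwo.hcoin_of_twists`).
-/

namespace Literature.AnabelianGeometry.SemiGraphs

open Filter Topology
open Literature.AnabelianGeometry.SemiGraphs.SemiGraphOfAnabelioids (IsProSigmaCompletion)
open Literature.AnabelianGeometry.AbsoluteAnabelian (IsTopologicallyFinitelyGenerated)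

/-! ### §1. Schedules `n : ℕ → ℕ` with `n_k → ∞` -/

namespace ThetaRaySchedule

/-- A schedule tending to infinity eventually dominates any prescribed modulus `M`.
[cite: MochizukiSemiAnbd2006, Thm 3.7(iii) p.41] -/
theorem eventually_le (n : ℕ → ℕ) (hn : Tendsto n atTop atTop) (M : ℕ) :
    ∃ N : ℕ, ∀ k, N ≤ k → M ≤ n k :=
  eventually_atTop.1 (tendsto_atTop.1 hn M)

/-- The same for the shifted schedule `k ↦ n (k+1)` (the exponent of the LOWER gluing at `v_{k+1}`, which
is where the apartment generators `z_k`, `z_{k+1}` are compared). [cite: MochizukiSemiAnbd2006, Thm 3.7(iii) p.41] -/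
theorem eventually_le_succ (n : ℕ → ℕ) (hn : Tendsto n atTop atTop) (M : ℕ) :
    ∃ N : ℕ, ∀ k, N ≤ k → M ≤ n (k + 1) := by
  obtain ⟨N, hN⟩ := eventually_le n hn M
  exact ⟨N, fun k hk => hN (k + 1) (Nat.le_succ_of_le hk)⟩

/-- A strictly increasing schedule tends to infinity. [cite: MochizukiSemiAnbd2006, Thm 3.7(iii) p.41] -/
theorem tendsto_of_strictMono {n : ℕ → ℕ} (hn : StrictMono n) : Tendsto n atTop atTop :=
  hn.tendsto_atTop

/-- A strictly increasing schedule dominates the position: `k ≤ n k`.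
[cite: MochizukiSemiAnbd2006, Thm 3.7(iii) p.41] -/
theorem le_self_of_strictMono {n : ℕ → ℕ} (hn : StrictMono n) (k : ℕ) : k ≤ n k :=
  hn.id_le k

/-- At a FIXED position `k` every sufficiently deep level modulus `e` satisfies `n k < e` (the input
`nk < e` of abc-iut-w6-d096's `hsep_of_abelianisation_zmod`): the schedule constrains the DEPTH of the level
used in (hcrit), never conversely. [cite: MochizukiSemiAnbd2006, Thm 3.7(iii) p.41] -/
theorem exists_forall_lt_level (n : ℕ → ℕ) (k : ℕ) : ∃ e₀ : ℕ, ∀ e, e₀ ≤ e → n k < e :=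
  ⟨n k + 1, fun _ he => he⟩

/-- Uniformly below a position: for all positions `i ≤ k` at once, deep levels satisfy `n i < e`.
[cite: MochizukiSemiAnbd2006, Thm 3.7(iii) p.41] -/
theorem exists_forall_le_lt_level (n : ℕ → ℕ) (k : ℕ) :
    ∃ e₀ : ℕ, ∀ e, e₀ ≤ e → ∀ i, i ≤ k → n i < e := by
  refine ⟨(Finset.range (k + 1)).sup n + 1, fun e he i hi => ?_⟩
  have h : n i ≤ (Finset.range (k + 1)).sup n :=
    Finset.le_sup (f := n) (Finset.mem_range.2 (Nat.lt_succ_of_le hi))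
  omega

/-! #### The schedule of record `n := fun k => k + 1` (no new definition) -/

/-- `k ↦ k + 1` is strictly increasing. [cite: MochizukiSemiAnbd2006, Thm 3.7(iii) p.41] -/
theorem strictMono_succ : StrictMono (fun k : ℕ => k + 1) := fun _ _ h => Nat.succ_lt_succ h

-- `k ↦ k + 1` tends to infinity: Mathlib's `Filter.tendsto_add_atTop_nat 1` (not restated).

/-- `0 + 1 = 1 ≥ 1` and generally `1 ≤ k + 1` (the memo's normalisation `n_0 ≥ 1`).
[cite: MochizukiSemiAnbd2006, Thm 3.7(iii) p.41] -/
theorem one_le_succ (k : ℕ) : 1 ≤ k + 1 := Nat.succ_le_succ (Nat.zero_le k)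

end ThetaRaySchedule

/-! ### §2. The coincidence binder (hcoin) from the schedule — generic binder form -/

namespace ThetaRaySchedule

section Generic

variable {G : Type*} [Group G]

/-- `(a · c)⁻¹ · a = c⁻¹`: with `θ_m a = a · b^{p^m}` the element compared in (hcoin) is
`(θ_m a)⁻¹ · a = b^{-p^m}`. [cite: MochizukiSemiAnbd2006, Thm 3.7(iii) p.41] -/
theorem inv_twist_mul_eq {a c θa : G} (h : θa = a * c) : θa⁻¹ * a = c⁻¹ := by
  rw [h, mul_inv_rev, inv_mul_cancel_right]

variable [TopologicalSpace G]

/-- **(hconv) from the twist formula**: if `θ_m (up e₀) = up e₀ · b^{p^m}` and every characteristic open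
core `charOpenCore G d` contains SOME `b^{p^M}`, then `(θ_m (up e₀))⁻¹ · up e₀ ∈ charOpenCore G d` for all
`m ≥ M` (R1b's `pow_prime_pow_mem_of_le`). [cite: MochizukiSemiAnbd2006, Thm 3.7(iii) p.41] -/
theorem hconv_of_pow_mem {E : Type*} (up : E → G) (θ : ℕ → G → G) (e₀ : E) {b : G} {p : ℕ}
    (hθa : ∀ m, θ m (up e₀) = up e₀ * b ^ p ^ m)
    (hb : ∀ d : ℕ, ∃ M : ℕ, b ^ p ^ M ∈ charOpenCore G d) :
    ∀ d : ℕ, ∃ M : ℕ, ∀ m, M ≤ m → (θ m (up e₀))⁻¹ * up e₀ ∈ charOpenCore G d := by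
  intro d
  obtain ⟨M, hM⟩ := hb d
  refine ⟨M, fun m hm => ?_⟩
  rw [inv_twist_mul_eq (hθa m)]
  exact Subgroup.inv_mem _ (TwistConvergence.pow_prime_pow_mem_of_le _ hM hm)

/-- **(hcoin) from (hconv) and the schedule**: for ANY schedule with `n_k → ∞`,
`(θ_{n_{k+1}} (up e₀))⁻¹ · up e₀ ∈ charOpenCore G d` for `k ≫ 0`. [cite: MochizukiSemiAnbd2006, Thm 3.7(iii) p.41] -/
theorem hcoin_of_tendsto {E : Type*} (up : E → G) (θ : ℕ → G → G) (e₀ : E) (n : ℕ → ℕ)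
    (hconv : ∀ d : ℕ, ∃ M : ℕ, ∀ m, M ≤ m → (θ m (up e₀))⁻¹ * up e₀ ∈ charOpenCore G d)
    (hn : Tendsto n atTop atTop) :
    ∀ d : ℕ, ∃ N : ℕ, ∀ k, N ≤ k → (θ (n (k + 1)) (up e₀))⁻¹ * up e₀ ∈ charOpenCore G d := by
  intro d
  obtain ⟨M, hM⟩ := hconv d
  obtain ⟨N, hN⟩ := eventually_le_succ n hn M
  exact ⟨N, fun k hk => hM _ (hN k hk)⟩

end Generic

section Continuous

variable {G E : Type*} [Group G] [TopologicalSpace G] [Group E] [TopologicalSpace E]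

/-- **(hcoin) VERBATIM in the currency of `thetaRayOfTwists G E up θ n`** (`low k := (θ (n k)).comp up`;
abc-iut-L3-t11's binder `(low (k+1) e₀)⁻¹ * up e₀ ∈ charOpenCore G d`), from (hconv) and `n_k → ∞`.
[cite: MochizukiSemiAnbd2006, Thm 3.7(iii) p.41] -/
theorem hcoin_comp_of_tendsto (up : E →ₜ* G) (θ : ℕ → (G →ₜ* G)) (e₀ : E) (n : ℕ → ℕ)
    (hconv : ∀ d : ℕ, ∃ M : ℕ, ∀ m, M ≤ m → (θ m (up e₀))⁻¹ * up e₀ ∈ charOpenCore G d)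
    (hn : Tendsto n atTop atTop) :
    ∀ d : ℕ, ∃ N : ℕ, ∀ k, N ≤ k →
      ((fun k => (θ (n k)).comp up) (k + 1) e₀)⁻¹ * up e₀ ∈ charOpenCore G d :=
  hcoin_of_tendsto up (fun m => θ m) e₀ n hconv hn

/-- **(hcoin) from the twist formula, a swallowed power and the schedule** — the three inputs of the R1
datum in binder form: `θ_m (up e₀) = up e₀ · b^{p^m}`, `∀ d, ∃ M, b^{p^M} ∈ charOpenCore G d`, `n_k → ∞`.
[cite: MochizukiSemiAnbd2006, Thm 3.7(iii) p.41] -/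
theorem hcoin_comp_of_pow_mem (up : E →ₜ* G) (θ : ℕ → (G →ₜ* G)) (e₀ : E) (n : ℕ → ℕ) {b : G} {p : ℕ}
    (hθa : ∀ m, θ m (up e₀) = up e₀ * b ^ p ^ m)
    (hb : ∀ d : ℕ, ∃ M : ℕ, b ^ p ^ M ∈ charOpenCore G d) (hn : Tendsto n atTop atTop) :
    ∀ d : ℕ, ∃ N : ℕ, ∀ k, N ≤ k →
      ((fun k => (θ (n k)).comp up) (k + 1) e₀)⁻¹ * up e₀ ∈ charOpenCore G d :=
  hcoin_comp_of_tendsto up θ e₀ n (hconv_of_pow_mem up (fun m => θ m) e₀ hθa hb) hn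

end Continuous

end ThetaRaySchedule

/-! ### §3. Pro-`p` input: characteristic open cores swallow `p`-power powers -/

/-- **In a topologically finitely generated pro-`{p}` completion every characteristic open core
`charOpenCore G d` contains some `b^{p^M}`** (it is open — `isOpen_charOpenCore_of_tfg` — and normal, and open
normal subgroups of a pro-`p` group have `p`-power index: R1b's `IsProSigmaCompletion.exists_pow_prime_pow_mem`).
[cite: RibesZalesskii2010, §2.1] -/
theorem _root_.Literature.AnabelianGeometry.SemiGraphs.SemiGraphOfAnabelioids.IsProSigmaCompletion.exists_pow_prime_pow_mem_charOpenCore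
    {G : Type*} [Group G] [TopologicalSpace G] [IsTopologicalGroup G] {Γ : Type*} [Group Γ] {p : ℕ}
    {ι : Γ →* G} (hι : IsProSigmaCompletion ({p} : Set ℕ) ι) (htfg : IsTopologicallyFinitelyGenerated G)
    (b : G) (d : ℕ) : ∃ M : ℕ, b ^ p ^ M ∈ charOpenCore G d := by
  haveI := charOpenCore_normal (Γ := G) d
  exact hι.exists_pow_prime_pow_mem (charOpenCore G d) (isOpen_charOpenCore_of_tfg htfg d) b

/-- … and then ALL later powers: `∃ M, ∀ m ≥ M, b^{p^m} ∈ charOpenCore G d`. [cite: RibesZalesskii2010, §2.1] -/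
theorem _root_.Literature.AnabelianGeometry.SemiGraphs.SemiGraphOfAnabelioids.IsProSigmaCompletion.exists_forall_pow_prime_pow_mem_charOpenCore
    {G : Type*} [Group G] [TopologicalSpace G] [IsTopologicalGroup G] {Γ : Type*} [Group Γ] {p : ℕ}
    {ι : Γ →* G} (hι : IsProSigmaCompletion ({p} : Set ℕ) ι) (htfg : IsTopologicallyFinitelyGenerated G)
    (b : G) (d : ℕ) : ∃ M : ℕ, ∀ m, M ≤ m → b ^ p ^ m ∈ charOpenCore G d := by
  obtain ⟨M, hM⟩ := hι.exists_pow_prime_pow_mem_charOpenCore htfg b d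
  exact ⟨M, fun m hm => TwistConvergence.pow_prime_pow_mem_of_le _ hM hm⟩

/-- **(hcoin) for a pro-`{p}` completion of `F₂`, binder form** (R1 interface `ι : FreeGroup (Fin 2) → G`,
`a := ι x₀`, `b := ι x₁`; gluing `up` with `up e₀ = a`; twists `θ_m a = a · b^{p^m}`; schedule `n_k → ∞`).
[cite: MochizukiSemiAnbd2006, Thm 3.7(iii) p.41] -/
theorem _root_.Literature.AnabelianGeometry.SemiGraphs.SemiGraphOfAnabelioids.IsProSigmaCompletion.hcoin_of_twists
    {G E : Type*} [Group G] [TopologicalSpace G] [IsTopologicalGroup G] [Group E] [TopologicalSpace E]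
    {p : ℕ} {ι : FreeGroup (Fin 2) →* G} (hι : IsProSigmaCompletion ({p} : Set ℕ) ι)
    (htfg : IsTopologicallyFinitelyGenerated G) (up : E →ₜ* G) (e₀ : E)
    (hup : up e₀ = ι (FreeGroup.of 0)) (θ : ℕ → (G →ₜ* G))
    (hθa : ∀ m, θ m (ι (FreeGroup.of 0)) = ι (FreeGroup.of 0) * ι (FreeGroup.of 1) ^ (p ^ m))
    (n : ℕ → ℕ) (hn : Tendsto n atTop atTop) :
    ∀ d : ℕ, ∃ N : ℕ, ∀ k, N ≤ k →
      ((fun k => (θ (n k)).comp up) (k + 1) e₀)⁻¹ * up e₀ ∈ charOpenCore G d :=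
  ThetaRaySchedule.hcoin_comp_of_pow_mem up θ e₀ n (b := ι (FreeGroup.of 1)) (p := p)
    (fun m => by rw [hup]; exact hθa m)
    (hι.exists_pow_prime_pow_mem_charOpenCore htfg _) hn

/-! ### §4. At the R1 datum `F̂₂⁽ᵖ⁾ = FreeProPRankTwo.Grp p` (abc-iut-w6-d019's brick R1, part 1 only) -/

namespace FreeProPRankTwo

variable (p : ℕ)

/-- In `F̂₂⁽ᵖ⁾`, every element has all its `p^m`-th powers, `m ≫ 0`, in any prescribed characteristic open
core. [cite: SerreGaloisCohomology1997, I §1.5] -/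
theorem exists_forall_pow_prime_pow_mem_charOpenCore (g : Grp p) (d : ℕ) :
    ∃ M : ℕ, ∀ m, M ≤ m → g ^ p ^ m ∈ charOpenCore (Grp p) d :=
  (isProSigmaCompletion_ι p).exists_forall_pow_prime_pow_mem_charOpenCore
    (isTopologicallyFinitelyGenerated p) g d

/-- **(hconv) at the R1 datum**: for twists `θ_m a = a · b^{p^m}` of `F̂₂⁽ᵖ⁾` and a gluing `α` with
`α e₀ = a`, `(θ_m (α e₀))⁻¹ · α e₀ = b^{-p^m} ∈ charOpenCore F̂₂⁽ᵖ⁾ d` for `m ≫ 0`.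
[cite: MochizukiSemiAnbd2006, Thm 3.7(iii) p.41] -/
theorem hconv_of_twists {E : Type*} [Group E] [TopologicalSpace E] (α : E →ₜ* Grp p) (e₀ : E)
    (hα : α e₀ = a p) (θ : ℕ → (Grp p →ₜ* Grp p)) (hθa : ∀ m, θ m (a p) = a p * b p ^ (p ^ m)) :
    ∀ d : ℕ, ∃ M : ℕ, ∀ m, M ≤ m → (θ m (α e₀))⁻¹ * α e₀ ∈ charOpenCore (Grp p) d :=
  ThetaRaySchedule.hconv_of_pow_mem α (fun m => θ m) e₀ (b := b p) (p := p)
    (fun m => by rw [hα]; exact hθa m)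
    (fun d => (exists_forall_pow_prime_pow_mem_charOpenCore p (b p) d).imp fun _ h => h _ le_rfl)

/-- **(hcoin) at the R1 datum, any schedule `n_k → ∞`** — VERBATIM the binder of abc-iut-L3-t11's
`thetaRay_hz_rayGen` / `thetaRay_not_compactInVerticial_of_hcrit` at
`thetaRayOfTwists (Grp p) E α θ n = thetaRay (Grp p) E α (fun k => (θ (n k)).comp α)`:
`((θ_{n_{k+1}} ∘ α) e₀)⁻¹ · α e₀ ∈ charOpenCore F̂₂⁽ᵖ⁾ d` for `k ≫ 0`.  Inputs in abc-iut-L3-t10's junction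
currency: `α`, `hα : α e₀ = a p`, `θ`, `hθa : θ m (a p) = a p * b p ^ p ^ m`, and the schedule.
[cite: MochizukiSemiAnbd2006, Thm 3.7(iii) p.41] -/
theorem hcoin_of_twists {E : Type*} [Group E] [TopologicalSpace E] (α : E →ₜ* Grp p) (e₀ : E)
    (hα : α e₀ = a p) (θ : ℕ → (Grp p →ₜ* Grp p)) (hθa : ∀ m, θ m (a p) = a p * b p ^ (p ^ m))
    (n : ℕ → ℕ) (hn : Tendsto n atTop atTop) :
    ∀ d : ℕ, ∃ N : ℕ, ∀ k, N ≤ k →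
      ((fun k => (θ (n k)).comp α) (k + 1) e₀)⁻¹ * α e₀ ∈ charOpenCore (Grp p) d :=
  ThetaRaySchedule.hcoin_comp_of_tendsto α θ e₀ n (hconv_of_twists p α e₀ hα θ hθa) hn

/-- (hcoin) at the R1 datum for a STRICTLY INCREASING schedule (the memo's shape).
[cite: MochizukiSemiAnbd2006, Thm 3.7(iii) p.41] -/
theorem hcoin_of_twists_strictMono {E : Type*} [Group E] [TopologicalSpace E] (α : E →ₜ* Grp p) (e₀ : E)
    (hα : α e₀ = a p) (θ : ℕ → (Grp p →ₜ* Grp p)) (hθa : ∀ m, θ m (a p) = a p * b p ^ (p ^ m))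
    (n : ℕ → ℕ) (hn : StrictMono n) :
    ∀ d : ℕ, ∃ N : ℕ, ∀ k, N ≤ k →
      ((fun k => (θ (n k)).comp α) (k + 1) e₀)⁻¹ * α e₀ ∈ charOpenCore (Grp p) d :=
  hcoin_of_twists p α e₀ hα θ hθa n (ThetaRaySchedule.tendsto_of_strictMono hn)

/-- **(hcoin) at the R1 datum with the schedule of record `n := Nat.succ`** (gluings `θ_{k+1} ∘ α` at
`β_k⁻`). [cite: MochizukiSemiAnbd2006, Thm 3.7(iii) p.41] -/
theorem hcoin_of_twists_succ {E : Type*} [Group E] [TopologicalSpace E] (α : E →ₜ* Grp p) (e₀ : E)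
    (hα : α e₀ = a p) (θ : ℕ → (Grp p →ₜ* Grp p)) (hθa : ∀ m, θ m (a p) = a p * b p ^ (p ^ m)) :
    ∀ d : ℕ, ∃ N : ℕ, ∀ k, N ≤ k →
      ((fun k => (θ ((fun k : ℕ => k + 1) k)).comp α) (k + 1) e₀)⁻¹ * α e₀ ∈ charOpenCore (Grp p) d :=
  hcoin_of_twists p α e₀ hα θ hθa (fun k => k + 1) (tendsto_add_atTop_nat 1)

/-- The (hcoin) element at the R1 datum IS `b^{-p^{n_{k+1}}}` (for the record; with `Multiplicative ℤ_[p]`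
and `e₀ = ofAdd 1` this is the memo's `b^{-p^{n_{k+1}}} ∈ G(d)`). [cite: MochizukiSemiAnbd2006, Thm 3.7(iii) p.41] -/
theorem hcoin_elt_eq {E : Type*} [Group E] [TopologicalSpace E] (α : E →ₜ* Grp p) (e₀ : E)
    (hα : α e₀ = a p) (θ : ℕ → (Grp p →ₜ* Grp p)) (hθa : ∀ m, θ m (a p) = a p * b p ^ (p ^ m))
    (n : ℕ → ℕ) (k : ℕ) :
    ((fun k => (θ (n k)).comp α) (k + 1) e₀)⁻¹ * α e₀ = (b p ^ p ^ n (k + 1))⁻¹ := by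
  show (θ (n (k + 1)) (α e₀))⁻¹ * α e₀ = _
  rw [hα]
  exact ThetaRaySchedule.inv_twist_mul_eq (hθa _)

end FreeProPRankTwo

/-! ### §5. UNCONDITIONAL at the concrete countermodel candidate `𝒢_θ(p, n)` (abc-iut-w6-d019's gluing
`FreeProPRankTwo.α p : ℤ_p → F̂₂⁽ᵖ⁾`, `ofAdd 1 ↦ a`, and twists `FreeProPRankTwo.θHom p m`, `a ↦ a·b^{p^m}`) -/

namespace FreeProPRankTwo

open Multiplicative

variable (p : ℕ)

/-- The memo's sentence verbatim: `b^{p^m} ∈ G(d)` (the characteristic open core of level `d`) for all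
`m ≫ 0`, in `F̂₂⁽ᵖ⁾`. [cite: MochizukiSemiAnbd2006, Thm 3.7(iii) p.41] -/
theorem exists_forall_b_pow_prime_pow_mem_charOpenCore (d : ℕ) :
    ∃ M : ℕ, ∀ m, M ≤ m → b p ^ p ^ m ∈ charOpenCore (Grp p) d :=
  exists_forall_pow_prime_pow_mem_charOpenCore p (b p) d

/-- … hence along any schedule `n_k → ∞`: `b^{p^{n_{k+1}}} ∈ G(d)` for `k ≫ 0` (memo (2a): "`θ_{n_k} → id`,
so `[z_k]_j = [z_{k+1}]_j` for `k ≥ m_j`"). [cite: MochizukiSemiAnbd2006, Thm 3.7(iii) p.41] -/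
theorem eventually_b_pow_prime_pow_schedule_mem_charOpenCore (n : ℕ → ℕ) (hn : Tendsto n atTop atTop)
    (d : ℕ) : ∃ N : ℕ, ∀ k, N ≤ k → b p ^ p ^ n (k + 1) ∈ charOpenCore (Grp p) d := by
  obtain ⟨M, hM⟩ := exists_forall_b_pow_prime_pow_mem_charOpenCore p d
  obtain ⟨N, hN⟩ := ThetaRaySchedule.eventually_le_succ n hn M
  exact ⟨N, fun k hk => hM _ (hN k hk)⟩

variable [Fact p.Prime]

/-- **(hcoin), UNCONDITIONAL, for every schedule `n_k → ∞`** at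
`𝒢_θ(p, n) = thetaRayOfTwists F̂₂⁽ᵖ⁾ ℤ_p (α p) (θHom p ·) n`, base element `e₀ = ofAdd 1`: the term for
abc-iut-L3-t11's binder (hcoin) of `thetaRay_not_compactInVerticial_of_hcrit` with NO group-theoretic input
left. [cite: MochizukiSemiAnbd2006, Thm 3.7(iii) p.41] -/
theorem hcoin_concrete (n : ℕ → ℕ) (hn : Tendsto n atTop atTop) :
    ∀ d : ℕ, ∃ N : ℕ, ∀ k, N ≤ k →
      ((fun k => (θHom p (n k)).comp (FreeProPRankTwo.α p)) (k + 1) (ofAdd (1 : ℤ_[p])))⁻¹ *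
          FreeProPRankTwo.α p (ofAdd (1 : ℤ_[p])) ∈ charOpenCore (Grp p) d :=
  hcoin_of_twists p (FreeProPRankTwo.α p) (ofAdd (1 : ℤ_[p])) (α_ofAdd_one p) (fun m => θHom p m)
    (fun m => by rw [θHom_apply, θ_a]) n hn

/-- (hcoin), unconditional, for every STRICTLY INCREASING schedule (the memo's shape).
[cite: MochizukiSemiAnbd2006, Thm 3.7(iii) p.41] -/
theorem hcoin_concrete_strictMono (n : ℕ → ℕ) (hn : StrictMono n) :
    ∀ d : ℕ, ∃ N : ℕ, ∀ k, N ≤ k →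
      ((fun k => (θHom p (n k)).comp (FreeProPRankTwo.α p)) (k + 1) (ofAdd (1 : ℤ_[p])))⁻¹ *
          FreeProPRankTwo.α p (ofAdd (1 : ℤ_[p])) ∈ charOpenCore (Grp p) d :=
  hcoin_concrete p n (ThetaRaySchedule.tendsto_of_strictMono hn)

/-- (hcoin), unconditional, with the schedule of record `n := fun k => k + 1`.
[cite: MochizukiSemiAnbd2006, Thm 3.7(iii) p.41] -/
theorem hcoin_concrete_succ :
    ∀ d : ℕ, ∃ N : ℕ, ∀ k, N ≤ k →
      ((fun k => (θHom p ((fun k : ℕ => k + 1) k)).comp (FreeProPRankTwo.α p)) (k + 1)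
            (ofAdd (1 : ℤ_[p])))⁻¹ *
          FreeProPRankTwo.α p (ofAdd (1 : ℤ_[p])) ∈ charOpenCore (Grp p) d :=
  hcoin_concrete p (fun k => k + 1) (tendsto_add_atTop_nat 1)

end FreeProPRankTwo

end Literature.AnabelianGeometry.SemiGraphs
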